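import Mathlib
import Literature.NumberTheory.Transcendental.BlochWignerDilogarithmProofs
import HarnessLib

/-!
# The Bloch–Wigner dilogarithm is real-differentiable on `ℂ ∖ {0, 1}`

Support file (everything PROVED; no new definitions of mathematical content beyond the derivative
packaging, no named facts) for the discharge of
`Literature.NumberTheory.Transcendental.BaileyEtAl2010_sqrt7_identity`.

* `hasDerivAt_dilog` — `Li₂'(z) = −log(1 − z)/z` off the cut `[1, ∞)` and `z ≠ 0`
  (differentiation under the integral sign in `Li₂(z) = −∫₀¹ log(1 − zs) ds/s`).
* `hasFDerivAt_blochWignerDilog_of_slit` — for `1 − z ∈ slitPlane`, `z ≠ 0`, the real derivative of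
  `D` is `h ↦ Im(c(z) h)` with `c(z) = −log|1 − z|/z − log|z|/(1 − z)` (Zagier 2007, Ch. I §3:
  `dD = log|z| d arg(1 − z) − log|1 − z| d arg z`).

References: D. Zagier, *The dilogarithm function* (2007), Ch. I §3. All statements are [folklore].
-/

noncomputable section

open MeasureTheory intervalIntegral Set Metric Filter
open scoped Topology ComplexConjugate Interval

namespace Literature.NumberTheory.Transcendental

/-! ### The segment `1 − z·[0,1]` stays in the slit plane -/

/-- If `1 − z ∉ (−∞, 0]` then `1 − zs ∉ (−∞, 0]` for all `s ∈ [0, 1]` (the slit plane is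
star-shaped about `1`). [folklore] -/
theorem one_sub_mul_mem_slitPlane {z : ℂ} (hz : 1 - z ∈ Complex.slitPlane) {s : ℝ}
    (hs : s ∈ Icc (0 : ℝ) 1) : 1 - z * (s : ℂ) ∈ Complex.slitPlane := by
  have h := Complex.starConvex_one_slitPlane hz (sub_nonneg.2 hs.2) hs.1 (by ring)
  convert h using 1
  simp only [Complex.real_smul]
  push_cast
  ring

/-- Uniform control near `z`: for `x` in a ball around `z` and `s ∈ [0,1]`, `1 − xs` stays in the
slit plane and `‖(1 − xs)⁻¹‖` is bounded. [folklore] -/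
theorem exists_ball_slit_inv_bound {z : ℂ} (hz : 1 - z ∈ Complex.slitPlane) :
    ∃ δ > 0, ∃ C, ∀ x ∈ ball z δ, ∀ s ∈ Icc (0 : ℝ) 1,
      1 - x * (s : ℂ) ∈ Complex.slitPlane ∧ ‖(1 - x * (s : ℂ))⁻¹‖ ≤ C := by
  set K := (fun s : ℝ => 1 - z * (s : ℂ)) '' Icc (0 : ℝ) 1 with hK
  have hKc : IsCompact K := isCompact_Icc.image (by fun_prop)
  have hKs : K ⊆ Complex.slitPlane := by
    rintro _ ⟨s, hs, rfl⟩
    exact one_sub_mul_mem_slitPlane hz hs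
  obtain ⟨δ, hδ, hsub⟩ := hKc.exists_cthickening_subset_open Complex.isOpen_slitPlane hKs
  have hTc : IsCompact (cthickening δ K) := hKc.cthickening
  have h0 : ∀ w ∈ cthickening δ K, w ≠ 0 := fun w hw => Complex.slitPlane_ne_zero (hsub hw)
  have hcont : ContinuousOn (fun w : ℂ => ‖w⁻¹‖) (cthickening δ K) :=
    (continuousOn_inv₀.mono fun w hw => h0 w hw).norm
  obtain ⟨C, hC⟩ := hTc.exists_bound_of_continuousOn hcont
  refine ⟨δ, hδ, C, fun x hx s hs => ?_⟩
  have hmem : 1 - x * (s : ℂ) ∈ cthickening δ K := by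
    refine Metric.mem_cthickening_of_dist_le _ (1 - z * (s : ℂ)) _ _ ⟨s, hs, rfl⟩ ?_
    rw [dist_eq_norm]
    have : (1 - x * (s : ℂ)) - (1 - z * (s : ℂ)) = (z - x) * (s : ℂ) := by ring
    rw [this, norm_mul, Complex.norm_real, Real.norm_eq_abs, abs_of_nonneg hs.1]
    calc ‖z - x‖ * s ≤ ‖z - x‖ * 1 := by gcongr; exact hs.2
      _ = dist x z := by rw [mul_one, dist_comm, dist_eq_norm]
      _ ≤ δ := (mem_ball.1 hx).le
  have := hC _ hmem
  simp only [Real.norm_eq_abs, abs_norm] at this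
  exact ⟨hsub hmem, this⟩

/-! ### The integrand of `Li₂` -/

/-- `d/dt log(1 − xt) = −x/(1 − xt)` along the real parameter. [folklore] -/
theorem hasDerivAt_clog_one_sub_mul (x : ℂ) {s : ℝ} (h : 1 - x * (s : ℂ) ∈ Complex.slitPlane) :
    HasDerivAt (fun t : ℝ => Complex.log (1 - x * (t : ℂ))) (-x / (1 - x * (s : ℂ))) s := by
  have h1 : HasDerivAt (fun t : ℝ => 1 - x * (t : ℂ)) (-x) s := by
    have h2 : HasDerivAt (fun w : ℂ => 1 - x * w) (-(x * 1)) (s : ℂ) :=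
      ((hasDerivAt_id (s : ℂ)).const_mul x).const_sub 1
    simpa using h2.comp_ofReal
  exact h1.clog_real h

/-- `d/dx log(1 − xt)/t = −1/(1 − xt)` in the complex parameter, `t ≠ 0`. [folklore] -/
theorem hasDerivAt_clog_one_sub_mul_div {t : ℝ} (ht : t ≠ 0) {x : ℂ}
    (h : 1 - x * (t : ℂ) ∈ Complex.slitPlane) :
    HasDerivAt (fun y : ℂ => Complex.log (1 - y * (t : ℂ)) / (t : ℂ)) (-(1 - x * (t : ℂ))⁻¹) x := by
  have h1 : HasDerivAt (fun y : ℂ => 1 - y * (t : ℂ)) (-(1 * (t : ℂ))) x :=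
    ((hasDerivAt_id x).mul_const (t : ℂ)).const_sub 1
  have h2 := (h1.clog h).div_const (t : ℂ)
  have ht' : (t : ℂ) ≠ 0 := Complex.ofReal_ne_zero.2 ht
  refine h2.congr_deriv ?_
  rw [one_mul, neg_div, neg_div, div_right_comm, div_self ht', one_div]

/-- The norm bound `‖log(1 − xt)‖ ≤ C‖x‖ t` on `[0,1]` when `‖(1 − xs)⁻¹‖ ≤ C` on `[0,1]`.
[folklore] -/
theorem norm_clog_one_sub_mul_le {x : ℂ} {C : ℝ}
    (hC : ∀ s ∈ Icc (0 : ℝ) 1, 1 - x * (s : ℂ) ∈ Complex.slitPlane ∧ ‖(1 - x * (s : ℂ))⁻¹‖ ≤ C)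
    {t : ℝ} (ht : t ∈ Icc (0 : ℝ) 1) : ‖Complex.log (1 - x * (t : ℂ))‖ ≤ C * ‖x‖ * t := by
  have hderiv : ∀ s ∈ uIcc (0 : ℝ) t,
      HasDerivAt (fun t : ℝ => Complex.log (1 - x * (t : ℂ))) (-x / (1 - x * (s : ℂ))) s := by
    intro s hs
    rw [uIcc_of_le ht.1] at hs
    exact hasDerivAt_clog_one_sub_mul x (hC s ⟨hs.1, hs.2.trans ht.2⟩).1
  have hcont : ContinuousOn (fun s : ℝ => -x / (1 - x * (s : ℂ))) (uIcc (0 : ℝ) t) := by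
    apply ContinuousOn.div continuousOn_const (by fun_prop)
    intro s hs
    rw [uIcc_of_le ht.1] at hs
    exact Complex.slitPlane_ne_zero (hC s ⟨hs.1, hs.2.trans ht.2⟩).1
  have hint : IntervalIntegrable (fun s : ℝ => -x / (1 - x * (s : ℂ))) volume 0 t :=
    hcont.intervalIntegrable
  have hftc := integral_eq_sub_of_hasDerivAt hderiv hint
  simp only [Complex.ofReal_zero, mul_zero, sub_zero, Complex.log_one] at hftc
  rw [← hftc]
  have hbound : ∀ s ∈ Ι (0 : ℝ) t, ‖-x / (1 - x * (s : ℂ))‖ ≤ C * ‖x‖ := by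
    intro s hs
    rw [uIoc_of_le ht.1] at hs
    rw [norm_div, norm_neg, div_eq_mul_inv, ← norm_inv, mul_comm]
    have := (hC s ⟨hs.1.le, hs.2.trans ht.2⟩).2
    gcongr
  calc ‖∫ s in (0 : ℝ)..t, -x / (1 - x * (s : ℂ))‖ ≤ C * ‖x‖ * |t - 0| :=
        norm_integral_le_of_norm_le_const hbound
    _ = C * ‖x‖ * t := by rw [sub_zero, abs_of_nonneg ht.1]

/-- The integrand `log(1 − xt)/t` of `Li₂(x)` is bounded by `C‖x‖` on `(0, 1]`. [folklore] -/
theorem norm_dilogIntegrand_le {x : ℂ} {C : ℝ}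
    (hC : ∀ s ∈ Icc (0 : ℝ) 1, 1 - x * (s : ℂ) ∈ Complex.slitPlane ∧ ‖(1 - x * (s : ℂ))⁻¹‖ ≤ C)
    {t : ℝ} (ht : t ∈ Ioc (0 : ℝ) 1) : ‖Complex.log (1 - x * (t : ℂ)) / (t : ℂ)‖ ≤ C * ‖x‖ := by
  rw [norm_div, Complex.norm_real, Real.norm_eq_abs, abs_of_pos ht.1, div_le_iff₀ ht.1]
  exact norm_clog_one_sub_mul_le hC ⟨ht.1.le, ht.2⟩

/-- Measurability of the integrand. [folklore] -/
theorem measurable_dilogIntegrand (x : ℂ) :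
    Measurable fun t : ℝ => Complex.log (1 - x * (t : ℂ)) / (t : ℂ) :=
  (Complex.measurable_log.comp (by fun_prop)).div (by fun_prop)

/-- The integrand of `Li₂(x)` is interval-integrable on `[0, 1]` for `x` off the cut `[1, ∞)`.
[folklore] -/
theorem intervalIntegrable_dilogIntegrand {x : ℂ} (hx : 1 - x ∈ Complex.slitPlane) :
    IntervalIntegrable (fun t : ℝ => Complex.log (1 - x * (t : ℂ)) / (t : ℂ)) volume 0 1 := by
  obtain ⟨δ, hδ, C, hC⟩ := exists_ball_slit_inv_bound hx
  have hCx := hC x (mem_ball_self hδ)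
  refine IntervalIntegrable.mono_fun' (g := fun _ => C * ‖x‖) intervalIntegrable_const
    (measurable_dilogIntegrand x).aestronglyMeasurable ?_
  rw [Filter.EventuallyLE, ae_restrict_iff' measurableSet_uIoc]
  refine Filter.Eventually.of_forall fun t ht => ?_
  rw [uIoc_of_le zero_le_one] at ht
  exact norm_dilogIntegrand_le hCx ht


/-! ### The derivative of `Li₂` -/

/-- `∫₀¹ dt/(1 − zt) = −log(1 − z)/z` for `z ≠ 0` off the cut. [folklore] -/
theorem integral_inv_one_sub_mul {z : ℂ} (hz : 1 - z ∈ Complex.slitPlane) (hz0 : z ≠ 0) :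
    ∫ t in (0 : ℝ)..1, (1 - z * (t : ℂ))⁻¹ = -Complex.log (1 - z) / z := by
  have hderiv : ∀ t ∈ uIcc (0 : ℝ) 1,
      HasDerivAt (fun t : ℝ => -Complex.log (1 - z * (t : ℂ)) / z) ((1 - z * (t : ℂ))⁻¹) t := by
    intro t ht
    rw [uIcc_of_le zero_le_one] at ht
    have hne : (1 - z * (t : ℂ)) ≠ 0 := Complex.slitPlane_ne_zero (one_sub_mul_mem_slitPlane hz ht)
    have h := ((hasDerivAt_clog_one_sub_mul z (one_sub_mul_mem_slitPlane hz ht)).neg).div_const z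
    refine h.congr_deriv ?_
    field_simp
  have hcont : ContinuousOn (fun t : ℝ => (1 - z * (t : ℂ))⁻¹) (uIcc (0 : ℝ) 1) := by
    refine ContinuousOn.inv₀ (by fun_prop) fun t ht => ?_
    rw [uIcc_of_le zero_le_one] at ht
    exact Complex.slitPlane_ne_zero (one_sub_mul_mem_slitPlane hz ht)
  rw [integral_eq_sub_of_hasDerivAt hderiv hcont.intervalIntegrable]
  simp

/-- **`Li₂'(z) = −log(1 − z)/z`** for `z ≠ 0` off the cut `[1, ∞)` (differentiation under the
integral sign). [folklore] -/
theorem hasDerivAt_dilog {z : ℂ} (hz : 1 - z ∈ Complex.slitPlane) (hz0 : z ≠ 0) :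
    HasDerivAt dilog (-Complex.log (1 - z) / z) z := by
  obtain ⟨δ, hδ, C, hC⟩ := exists_ball_slit_inv_bound hz
  have key := intervalIntegral.hasDerivAt_integral_of_dominated_loc_of_deriv_le
    (𝕜 := ℂ) (μ := volume) (a := (0 : ℝ)) (b := 1)
    (F := fun (x : ℂ) (t : ℝ) => Complex.log (1 - x * (t : ℂ)) / (t : ℂ))
    (F' := fun (x : ℂ) (t : ℝ) => -(1 - x * (t : ℂ))⁻¹) (x₀ := z)
    (bound := fun _ => C) (ball_mem_nhds z hδ)
    (Filter.Eventually.of_forall fun x => (measurable_dilogIntegrand x).aestronglyMeasurable)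
    (intervalIntegrable_dilogIntegrand hz)
    ((Measurable.inv (by fun_prop)).neg.aestronglyMeasurable)
    (Filter.Eventually.of_forall fun t ht x hx => by
      rw [uIoc_of_le zero_le_one] at ht
      rw [norm_neg]
      exact (hC x hx t ⟨ht.1.le, ht.2⟩).2)
    intervalIntegrable_const
    (Filter.Eventually.of_forall fun t ht x hx => by
      rw [uIoc_of_le zero_le_one] at ht
      exact hasDerivAt_clog_one_sub_mul_div ht.1.ne' (hC x hx t ⟨ht.1.le, ht.2⟩).1)
  have h2 := key.2.neg
  rw [intervalIntegral.integral_neg, integral_inv_one_sub_mul hz hz0, neg_neg] at h2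
  have hfun :
      (-fun x : ℂ => ∫ t in (0 : ℝ)..1, Complex.log (1 - x * (t : ℂ)) / (t : ℂ)) = dilog := by
    funext x; simp only [Pi.neg_apply, dilog]
  rw [hfun] at h2
  exact h2

/-! ### The real derivative of `D` off the cut -/

/-- `d log‖w‖ = Re(dw/w)`: the real derivative of `w ↦ log ‖w‖` at `z ≠ 0`. [folklore] -/
theorem hasFDerivAt_log_norm {z : ℂ} (hz0 : z ≠ 0) :
    HasFDerivAt (fun w : ℂ => Real.log ‖w‖)
      (Complex.reCLM.comp ((z⁻¹ • (1 : ℂ →L[ℂ] ℂ)).restrictScalars ℝ)) z := by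
  have hns : HasFDerivAt (fun w : ℂ => Complex.normSq w)
      ((2 * z.re) • Complex.reCLM + (2 * z.im) • Complex.imCLM) z := by
    have hr : HasFDerivAt (fun w : ℂ => w.re) Complex.reCLM z := Complex.reCLM.hasFDerivAt
    have hi : HasFDerivAt (fun w : ℂ => w.im) Complex.imCLM z := Complex.imCLM.hasFDerivAt
    have h := (hr.mul hr).add (hi.mul hi)
    have hf : (fun w : ℂ => Complex.normSq w) = (fun w : ℂ => w.re) * (fun w : ℂ => w.re) +
        (fun w : ℂ => w.im) * (fun w : ℂ => w.im) := by
      funext w; simp [Complex.normSq_apply]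
    rw [hf]
    refine h.congr_fderiv ?_
    ext h
    simp
    ring
  have hnz : Complex.normSq z ≠ 0 := (Complex.normSq_pos.2 hz0).ne'
  have hlog := (hns.log hnz).const_mul (1 / 2 : ℝ)
  have hf : (fun w : ℂ => Real.log ‖w‖) = fun w => 1 / 2 * Real.log (Complex.normSq w) := by
    funext w
    rw [Complex.normSq_eq_norm_sq, Real.log_pow]
    ring
  rw [hf]
  refine hlog.congr_fderiv ?_
  ext h
  simp [Complex.inv_re, Complex.inv_im]
  field_simp
  ring

/-- **The real derivative of `D` off the cut**: for `1 − z ∉ (−∞,0]` and `z ≠ 0`,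
`dD_z(h) = Im(c(z)·h)` with `c(z) = −log|1 − z|/z − log|z|/(1 − z)`
(Zagier 2007, Ch. I §3: `dD = log|z| d arg(1−z) − log|1−z| d arg z`). [folklore] -/
theorem hasFDerivAt_blochWignerDilog_of_slit {z : ℂ} (hz : 1 - z ∈ Complex.slitPlane)
    (hz0 : z ≠ 0) :
    HasFDerivAt blochWignerDilog
      (Complex.imCLM.comp
        (((-(Real.log ‖1 - z‖ : ℂ) / z - (Real.log ‖z‖ : ℂ) / (1 - z)) •
          (1 : ℂ →L[ℂ] ℂ)).restrictScalars ℝ))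
      z := by
  -- the three constituents
  have hL : HasFDerivAt (fun w => (dilog w).im)
      (Complex.imCLM.comp (((-Complex.log (1 - z) / z) • (1 : ℂ →L[ℂ] ℂ)).restrictScalars ℝ))
      z := by
    have hd := (hasDerivAt_dilog hz hz0).hasFDerivAt.restrictScalars ℝ
    have := Complex.imCLM.hasFDerivAt.comp z hd
    refine this.congr_fderiv ?_
    ext h
    simp [mul_comm]
  have hA : HasFDerivAt (fun w => Complex.arg (1 - w))
      (Complex.imCLM.comp (((-1 / (1 - z)) • (1 : ℂ →L[ℂ] ℂ)).restrictScalars ℝ)) z := by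
    have h1 : HasDerivAt (fun w : ℂ => Complex.log (1 - w)) (-1 / (1 - z)) z :=
      ((hasDerivAt_id z).const_sub 1).clog hz
    have := Complex.imCLM.hasFDerivAt.comp z (h1.hasFDerivAt.restrictScalars ℝ)
    have hf : (fun w => Complex.arg (1 - w)) = fun w => (Complex.log (1 - w)).im := by
      funext w; rw [Complex.log_im]
    rw [hf]
    refine this.congr_fderiv ?_
    ext h
    simp [mul_comm]
  have hN := hasFDerivAt_log_norm hz0
  have hD := hL.add (hA.mul hN)
  have hf : blochWignerDilog = (fun w => (dilog w).im) +
      (fun w => Complex.arg (1 - w)) * (fun w : ℂ => Real.log ‖w‖) := by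
    funext w; simp [blochWignerDilog]
  rw [hf]
  refine hD.congr_fderiv ?_
  ext h
  have hlog :
      Complex.log (1 - z) = (Real.log ‖1 - z‖ : ℂ) + (Complex.arg (1 - z) : ℂ) * Complex.I :=
    rfl
  simp only [hlog, div_eq_mul_inv, neg_mul, one_mul]
  simp
  ring


/-! ### The functional `h ↦ Im(c·h)` and the chain rule

Below, the coefficient of `dD = Im(c(z) dz)` is always written out as
`c(z) = -↑(Real.log ‖1 - z‖) / z - ↑(Real.log ‖z‖) / (1 - z)` and the real-linear functional
`h ↦ Im(c·h)` as `Complex.imCLM.comp (ContinuousLinearMap.restrictScalars ℝ (c • 1))`. -/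

/-- `Im(c·h)` as the value of the functional `imCLM ∘ (c • 1)`. [folklore] -/
theorem imCLM_comp_smul_apply (c h : ℂ) :
    (Complex.imCLM.comp (ContinuousLinearMap.restrictScalars ℝ (c • (1 : ℂ →L[ℂ] ℂ)))) h =
      (c * h).im := by
  simp

/-- Additivity of `c ↦ imCLM ∘ (c • 1)`. [folklore] -/
theorem imCLM_comp_smul_add (c d : ℂ) :
    Complex.imCLM.comp (ContinuousLinearMap.restrictScalars ℝ ((c + d) • (1 : ℂ →L[ℂ] ℂ))) =
      Complex.imCLM.comp (ContinuousLinearMap.restrictScalars ℝ (c • (1 : ℂ →L[ℂ] ℂ))) +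
        Complex.imCLM.comp (ContinuousLinearMap.restrictScalars ℝ (d • (1 : ℂ →L[ℂ] ℂ))) := by
  ext h; simp [add_mul]

/-- `imCLM ∘ (0 • 1) = 0`. [folklore] -/
theorem imCLM_comp_smul_zero :
    Complex.imCLM.comp (ContinuousLinearMap.restrictScalars ℝ ((0 : ℂ) • (1 : ℂ →L[ℂ] ℂ))) = 0 := by
  ext h; simp

/-- Real homogeneity of `c ↦ imCLM ∘ (c • 1)`. [folklore] -/
theorem imCLM_comp_smul_real_mul (r : ℝ) (c : ℂ) :
    Complex.imCLM.comp (ContinuousLinearMap.restrictScalars ℝ (((r : ℂ) * c) • (1 : ℂ →L[ℂ] ℂ))) =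
      r • Complex.imCLM.comp (ContinuousLinearMap.restrictScalars ℝ (c • (1 : ℂ →L[ℂ] ℂ))) := by
  ext h; simp [mul_assoc]

/-- Chain rule for `D ∘ φ` along a holomorphic `φ`, given the derivative of `D` at `φ x` in the
form `h ↦ Im(c·h)`. [folklore] -/
theorem hasFDerivAt_blochWignerDilog_comp_of {φ : ℂ → ℂ} {φ' x c : ℂ}
    (hD : HasFDerivAt blochWignerDilog
      (Complex.imCLM.comp (ContinuousLinearMap.restrictScalars ℝ (c • (1 : ℂ →L[ℂ] ℂ)))) (φ x))
    (hφ : HasDerivAt φ φ' x) :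
    HasFDerivAt (fun y => blochWignerDilog (φ y))
      (Complex.imCLM.comp (ContinuousLinearMap.restrictScalars ℝ ((c * φ') • (1 : ℂ →L[ℂ] ℂ))))
      x := by
  have := hD.comp x (hφ.hasFDerivAt.restrictScalars ℝ)
  refine this.congr_fderiv ?_
  ext h
  simp
  ring

/-- The coefficient identity behind `D(1/z) = −D(z)`: `c(1/w)·d(1/w) = −c(w) dw`. [folklore] -/
theorem bwc_inv_mul {w : ℂ} (h0 : w ≠ 0) (h1 : w ≠ 1) :
    (-((Real.log ‖1 - w⁻¹‖ : ℝ) : ℂ) / w⁻¹ - ((Real.log ‖w⁻¹‖ : ℝ) : ℂ) / (1 - w⁻¹)) *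
        (-(w ^ 2)⁻¹) =
      -(-((Real.log ‖1 - w‖ : ℝ) : ℂ) / w - ((Real.log ‖w‖ : ℝ) : ℂ) / (1 - w)) := by
  have hn0 : ‖w‖ ≠ 0 := norm_ne_zero_iff.2 h0
  have h1' : (1 : ℂ) - w ≠ 0 := sub_ne_zero.2 (Ne.symm h1)
  have h1'' : w - 1 ≠ 0 := sub_ne_zero.2 h1
  have hn1 : ‖(1 : ℂ) - w‖ ≠ 0 := norm_ne_zero_iff.2 h1'
  have e1 : Real.log ‖w⁻¹‖ = -Real.log ‖w‖ := by rw [norm_inv, Real.log_inv]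
  have e2 : Real.log ‖(1 : ℂ) - w⁻¹‖ = Real.log ‖(1 : ℂ) - w‖ - Real.log ‖w‖ := by
    rw [show (1 : ℂ) - w⁻¹ = (w - 1) / w by field_simp, norm_div, norm_sub_rev,
      Real.log_div hn1 hn0]
  rw [e1, e2]
  push_cast
  field_simp
  ring

/-- The coefficient identity behind `D(1 − z) = −D(z)`: `c(1 − w)·d(1 − w) = −c(w) dw`.
[folklore] -/
theorem bwc_one_sub_mul (w : ℂ) :
    (-((Real.log ‖1 - (1 - w)‖ : ℝ) : ℂ) / (1 - w) - ((Real.log ‖1 - w‖ : ℝ) : ℂ) / (1 - (1 - w))) *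
        (-1) =
      -(-((Real.log ‖1 - w‖ : ℝ) : ℂ) / w - ((Real.log ‖w‖ : ℝ) : ℂ) / (1 - w)) := by
  simp only [sub_sub_cancel]
  ring

/-! ### `D(1/z) = −D(z)` and `D(1 − z) = −D(z)` -/

/-- **Inversion relation** `D(1/z) = −D(z)` for every `z ∈ ℂ` (Zagier 2007, Ch. I §3). Proof:
on the upper half plane `w ↦ D(1/w) + D(w)` has zero derivative, hence is constant, and vanishes
at `w = i` because `1/i = ī`; the lower half plane follows by conjugation and the real line is
where `D` vanishes. [folklore] -/
theorem blochWignerDilog_inv (z : ℂ) : blochWignerDilog z⁻¹ = -blochWignerDilog z := by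
  have key : ∀ w : ℂ, 0 < w.im → blochWignerDilog w⁻¹ = -blochWignerDilog w := by
    intro w hw
    let U : Set ℂ := {v | 0 < v.im}
    have hUo : IsOpen U := isOpen_lt continuous_const Complex.continuous_im
    have hUc : IsPreconnected U := (convex_halfSpace_im_gt 0).isPreconnected
    let f : ℂ → ℝ := fun v => blochWignerDilog v⁻¹ + blochWignerDilog v
    have hderiv : ∀ v ∈ U, HasFDerivAt f (0 : ℂ →L[ℝ] ℝ) v := by
      intro v hv
      have hv : 0 < v.im := hv
      have hv0 : v ≠ 0 := fun h => by simp [h] at hv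
      have hv1 : v ≠ 1 := fun h => by simp [h] at hv
      have hvs : 1 - v ∈ Complex.slitPlane := Or.inr (by simpa using hv.ne')
      have hvi0 : v⁻¹ ≠ 0 := inv_ne_zero hv0
      have hvis : 1 - v⁻¹ ∈ Complex.slitPlane := by
        refine Or.inr ?_
        have hn : 0 < Complex.normSq v := Complex.normSq_pos.2 hv0
        simp only [Complex.sub_im, Complex.one_im, Complex.inv_im, zero_sub, neg_div, neg_neg]
        exact (div_pos hv hn).ne'
      have h1 := hasFDerivAt_blochWignerDilog_of_slit hvis hvi0
      have h2 := hasFDerivAt_blochWignerDilog_comp_of h1 (hasDerivAt_inv hv0)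
      have h3 := hasFDerivAt_blochWignerDilog_of_slit hvs hv0
      have h4 := h2.add h3
      refine h4.congr_fderiv ?_
      rw [bwc_inv_mul hv0 hv1]
      ext h
      simp
      ring
    have hdiff : DifferentiableOn ℝ f U := fun v hv =>
      (hderiv v hv).differentiableAt.differentiableWithinAt
    have hfd : U.EqOn (fderiv ℝ f) 0 := fun v hv => (hderiv v hv).fderiv
    have hI : Complex.I ∈ U := by simp [U]
    have hconst := hUo.is_const_of_fderiv_eq_zero hUc hdiff hfd (show w ∈ U from hw) hI
    have hfI : f Complex.I = 0 := by
      simp only [f, Complex.inv_I]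
      rw [show -Complex.I = conj Complex.I by simp, blochWignerDilog_conj']
      ring
    have hfw : f w = 0 := hconst.trans hfI
    have : blochWignerDilog w⁻¹ + blochWignerDilog w = 0 := hfw
    linarith
  rcases lt_trichotomy z.im 0 with hlt | heq | hgt
  · have h := key (conj z) (by simpa using hlt)
    rw [← map_inv₀, blochWignerDilog_conj', blochWignerDilog_conj'] at h
    linarith
  · rw [blochWignerDilog_of_im_eq_zero heq,
      blochWignerDilog_of_im_eq_zero (by simp [Complex.inv_im, heq]), neg_zero]
  · exact key z hgt

/-- **Reflection relation** `D(1 − z) = −D(z)` for every `z ∈ ℂ` (Zagier 2007, Ch. I §3); same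
proof with base point `w = (1 + i)/2`, where `1 − w = w̄`. [folklore] -/
theorem blochWignerDilog_one_sub (z : ℂ) : blochWignerDilog (1 - z) = -blochWignerDilog z := by
  have key : ∀ w : ℂ, 0 < w.im → blochWignerDilog (1 - w) = -blochWignerDilog w := by
    intro w hw
    let U : Set ℂ := {v | 0 < v.im}
    have hUo : IsOpen U := isOpen_lt continuous_const Complex.continuous_im
    have hUc : IsPreconnected U := (convex_halfSpace_im_gt 0).isPreconnected
    let f : ℂ → ℝ := fun v => blochWignerDilog (1 - v) + blochWignerDilog v
    have hderiv : ∀ v ∈ U, HasFDerivAt f (0 : ℂ →L[ℝ] ℝ) v := by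
      intro v hv
      have hv : 0 < v.im := hv
      have hv0 : v ≠ 0 := fun h => by simp [h] at hv
      have hvs : 1 - v ∈ Complex.slitPlane := Or.inr (by simpa using hv.ne')
      have hv1 : (1 : ℂ) - v ≠ 0 := Complex.slitPlane_ne_zero hvs
      have hvs' : 1 - (1 - v) ∈ Complex.slitPlane := by
        rw [sub_sub_cancel]; exact Or.inr hv.ne'
      have h1 := hasFDerivAt_blochWignerDilog_of_slit hvs' hv1
      have h2 := hasFDerivAt_blochWignerDilog_comp_of h1 ((hasDerivAt_id v).const_sub 1)
      have h3 := hasFDerivAt_blochWignerDilog_of_slit hvs hv0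
      have h4 := h2.add h3
      refine h4.congr_fderiv ?_
      rw [bwc_one_sub_mul v]
      ext h
      simp
      ring
    have hdiff : DifferentiableOn ℝ f U := fun v hv =>
      (hderiv v hv).differentiableAt.differentiableWithinAt
    have hfd : U.EqOn (fderiv ℝ f) 0 := fun v hv => (hderiv v hv).fderiv
    have hI : (⟨2⁻¹, 2⁻¹⟩ : ℂ) ∈ U := by show (0 : ℝ) < 2⁻¹; norm_num
    have hconst := hUo.is_const_of_fderiv_eq_zero hUc hdiff hfd (show w ∈ U from hw) hI
    have hfI : f ⟨2⁻¹, 2⁻¹⟩ = 0 := by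
      have hc : (1 : ℂ) - ⟨2⁻¹, 2⁻¹⟩ = conj (⟨2⁻¹, 2⁻¹⟩ : ℂ) := by
        apply Complex.ext <;> norm_num
      simp only [f]
      rw [hc, blochWignerDilog_conj']
      ring
    have hfw : f w = 0 := hconst.trans hfI
    have : blochWignerDilog (1 - w) + blochWignerDilog w = 0 := hfw
    linarith
  rcases lt_trichotomy z.im 0 with hlt | heq | hgt
  · have h := key (conj z) (by simpa using hlt)
    rw [show 1 - conj z = conj (1 - z) by simp, blochWignerDilog_conj', blochWignerDilog_conj'] at h
    linarith
  · rw [blochWignerDilog_of_im_eq_zero heq, blochWignerDilog_of_im_eq_zero (by simp [heq]),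
      neg_zero]
  · exact key z hgt

/-! ### The derivative across the cut and on all of `ℂ ∖ {0, 1}` -/

/-- The real derivative of `D` at a point of the cut `(1, ∞)`, obtained from `D(z) = −D(1/z)`
and the derivative at `1/x ∈ (0, 1)`. [folklore] -/
theorem hasFDerivAt_blochWignerDilog_of_one_lt {x : ℝ} (hx : 1 < x) :
    HasFDerivAt blochWignerDilog
      (Complex.imCLM.comp (ContinuousLinearMap.restrictScalars ℝ
        ((-((Real.log ‖1 - (x : ℂ)‖ : ℝ) : ℂ) / (x : ℂ) -
            ((Real.log ‖(x : ℂ)‖ : ℝ) : ℂ) / (1 - (x : ℂ))) •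
          (1 : ℂ →L[ℂ] ℂ)))) x := by
  have hx0 : (x : ℂ) ≠ 0 := by exact_mod_cast (by linarith : x ≠ 0)
  have hx1 : (x : ℂ) ≠ 1 := by exact_mod_cast (by linarith : x ≠ 1)
  have hslit : 1 - (x : ℂ)⁻¹ ∈ Complex.slitPlane := by
    have : 1 - (x : ℂ)⁻¹ = ((1 - x⁻¹ : ℝ) : ℂ) := by push_cast; ring
    rw [this, Complex.ofReal_mem_slitPlane, sub_pos]
    exact inv_lt_one_of_one_lt₀ hx
  have h1 := hasFDerivAt_blochWignerDilog_of_slit hslit (inv_ne_zero hx0)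
  have h2 := (hasFDerivAt_blochWignerDilog_comp_of h1 (hasDerivAt_inv hx0)).neg
  have hfun : (-fun y : ℂ => blochWignerDilog y⁻¹) = blochWignerDilog := by
    funext y; simp [blochWignerDilog_inv]
  rw [hfun] at h2
  refine h2.congr_fderiv ?_
  rw [bwc_inv_mul hx0 hx1]
  ext h
  simp
  ring

/-- **`D` is real-differentiable on `ℂ ∖ {0, 1}`** with `dD_z(h) = Im(c(z) h)`,
`c(z) = −log|1 − z|/z − log|z|/(1 − z)` (Zagier 2007, Ch. I §3: "`D(z)` is real-analytic on
`ℂ ∖ {0, 1}`", `dD = log|z| d arg(1 − z) − log|1 − z| d arg z`). [folklore] -/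
theorem hasFDerivAt_blochWignerDilog {z : ℂ} (h0 : z ≠ 0) (h1 : z ≠ 1) :
    HasFDerivAt blochWignerDilog
      (Complex.imCLM.comp (ContinuousLinearMap.restrictScalars ℝ
        ((-((Real.log ‖1 - z‖ : ℝ) : ℂ) / z - ((Real.log ‖z‖ : ℝ) : ℂ) / (1 - z)) •
          (1 : ℂ →L[ℂ] ℂ)))) z := by
  by_cases hs : 1 - z ∈ Complex.slitPlane
  · exact hasFDerivAt_blochWignerDilog_of_slit hs h0
  · rw [Complex.mem_slitPlane_iff, not_or, not_lt] at hs
    obtain ⟨hre, him⟩ := hs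
    have hzim : z.im = 0 := by simpa using him
    have hz : z = (z.re : ℂ) := Complex.ext (by simp) (by simp [hzim])
    have hle : 1 ≤ z.re := by
      have : (1 - z).re = 1 - z.re := by simp
      linarith [this ▸ hre]
    have hne : z.re ≠ 1 := by
      intro h; apply h1; rw [hz, h]; simp
    have hlt : 1 < z.re := lt_of_le_of_ne hle (Ne.symm hne)
    rw [hz]
    exact hasFDerivAt_blochWignerDilog_of_one_lt hlt

/-- `D` is real-differentiable at every `z ∉ {0, 1}`. [folklore] -/
theorem differentiableAt_blochWignerDilog {z : ℂ} (h0 : z ≠ 0) (h1 : z ≠ 1) :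
    DifferentiableAt ℝ blochWignerDilog z :=
  (hasFDerivAt_blochWignerDilog h0 h1).differentiableAt

/-- `D` is continuous at every `z ∉ {0, 1}`. [folklore] -/
theorem continuousAt_blochWignerDilog {z : ℂ} (h0 : z ≠ 0) (h1 : z ≠ 1) :
    ContinuousAt blochWignerDilog z :=
  (hasFDerivAt_blochWignerDilog h0 h1).continuousAt

/-- **Chain rule for `D ∘ φ`**: for `φ` complex-differentiable at `x` with `φ x ∉ {0, 1}`,
`d(D ∘ φ)_x(h) = Im(c(φ x) φ'(x) h)`. This is the form used to verify functional equations of `D`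
by differentiation. [folklore] -/
theorem HasDerivAt.blochWignerDilog_comp {φ : ℂ → ℂ} {φ' x : ℂ} (hφ : HasDerivAt φ φ' x)
    (h0 : φ x ≠ 0) (h1 : φ x ≠ 1) :
    HasFDerivAt (fun y => blochWignerDilog (φ y))
      (Complex.imCLM.comp (ContinuousLinearMap.restrictScalars ℝ
        (((-((Real.log ‖1 - φ x‖ : ℝ) : ℂ) / φ x - ((Real.log ‖φ x‖ : ℝ) : ℂ) / (1 - φ x)) * φ') •
          (1 : ℂ →L[ℂ] ℂ)))) x :=
  hasFDerivAt_blochWignerDilog_comp_of (hasFDerivAt_blochWignerDilog h0 h1) hφ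

end Literature.NumberTheory.Transcendental
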